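import Literature.Geometry.ComplexHyperbolic.UnitBallU21
import HarnessLib

/-!
# `U(2,1)` as a locally compact second-countable group with its Borel σ-algebra

Topic `Geometry/ComplexHyperbolic`; namespace `Literature.Geometry.ComplexHyperbolic.BallModel`
(continues `UnitBallU21`).

The tree's `U21 : Subgroup GL3` (`GL3 = GL (Fin 3) ℂ`, `UnitBallU21`) carries the subspace topology
of `GL₃(ℂ)` (Mathlib's topology on units, induced by `g ↦ (g, g⁻¹)`), hence is a Hausdorff
topological group. This file records the point-set facts every MEASURE-theoretic use of `U(2,1)`
needs (Haar measure, fundamental domains of lattices, push-forward along `G_∞ → U(2,1)`):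

* §1 `isEmbedding_val_GL3` : `GL₃(ℂ) → M₃(ℂ)` is a topological embedding (matrix inversion is
  continuous on invertible matrices), `isClosedEmbedding_mat` : `mat : U21 → M₃(ℂ)` is a CLOSED
  embedding with range `{g | gᴴ J g = J}` (`range_mat`), `isClosed_U21` : `U21` is closed in `GL₃(ℂ)`;
* §2 instances on `U21`: `LocallyCompactSpace`, `SecondCountableTopology`, `SigmaCompactSpace`
  (from §1), the Borel σ-algebra `MeasurableSpace U21 := borel U21` with `BorelSpace U21`, and the
  derived measurability instances used by Mathlib's Haar / fundamental-domain API
  (`MeasurableMul₂`, `MeasurableInv`, `MeasurableSMul U21 Ball` is NOT declared here — `Ball` has no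
  measurable structure in the tree yet);
* §3 `exists_isHaarMeasure_U21` : a Haar measure on `U21` exists (Mathlib `Measure.haar`).

Everything is elementary point-set topology over Mathlib and is PROVED (kernel only, no records);
the cite tags are provenance labels. Sources: Jacobowitz 1990 Ch. 2 §1 p. 40 (`U(2,1) ⊂ GL₃(ℂ)` is
the closed subgroup `{A : A*CA = C}`); Folland, *A Course in Abstract Harmonic Analysis* (1995) §2.2
(closed subgroups of locally compact groups are locally compact and carry Haar measures).
Deliberately NOT here: compactness of the stabiliser `U(2) × U(1)` of the centre, unimodularity,
the invariant measure on the ball.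
-/

open Matrix Topology MeasureTheory

namespace Literature.Geometry.ComplexHyperbolic

namespace BallModel

/-! ## §1 Closed embeddings into matrices -/

/-- The coercion `GL₃(ℂ) → M₃(ℂ)` is a topological embedding: Mathlib's topology on units is
induced by `g ↦ (g, g⁻¹)`, and matrix inversion is continuous at every invertible matrix
(`Ring.inverse` is continuous at the units of `ℂ`). [folklore] -/
theorem isEmbedding_val_GL3 : IsEmbedding (Units.val : GL3 → Matrix (Fin 3) (Fin 3) ℂ) := by
  refine Units.isEmbedding_val_mk' (f := fun A : Matrix (Fin 3) (Fin 3) ℂ ↦ A⁻¹) ?_ ?_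
  · intro A hA
    refine (continuousAt_matrix_inv A ?_).continuousWithinAt
    obtain ⟨d, hd⟩ := (Matrix.isUnit_iff_isUnit_det A).mp hA
    rw [← hd]
    exact NormedRing.inverse_continuousAt d
  · intro u
    exact (Matrix.coe_units_inv u).symm

/-- The range of `mat : U21 → M₃(ℂ)` is the closed condition `gᴴ J g = J`. [folklore] -/
theorem range_mat :
    Set.range mat = {g : Matrix (Fin 3) (Fin 3) ℂ | gᴴ * J * g = J} := by
  ext g
  constructor
  · rintro ⟨h, rfl⟩
    exact mat_mem h
  · intro hg
    exact ⟨mkU21 g hg, rfl⟩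

/-- `{g ∈ M₃(ℂ) | gᴴ J g = J}` is closed. [folklore] -/
theorem isClosed_setOf_preserves :
    IsClosed {g : Matrix (Fin 3) (Fin 3) ℂ | gᴴ * J * g = J} := by
  have hc : Continuous fun g : Matrix (Fin 3) (Fin 3) ℂ ↦ gᴴ * J * g :=
    (continuous_id.matrix_conjTranspose.matrix_mul continuous_const).matrix_mul continuous_id
  exact isClosed_eq hc continuous_const

/-- `mat : U21 → M₃(ℂ)` is injective. [folklore] -/
theorem mat_injective : Function.Injective mat := fun _ _ hgh ↦
  Subtype.ext (Units.ext hgh)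

/-- `mat : U21 → M₃(ℂ)` is a closed embedding ("`U(2,1)` is a closed subgroup of `GL₃(ℂ)`, itself
locally closed in `M₃(ℂ)`; on `U(2,1)` the two subspace topologies agree").
[cite: Jacobowitz1990, Ch. 2 §1 (p. 40)] -/
theorem isClosedEmbedding_mat : IsClosedEmbedding mat where
  toIsEmbedding := isEmbedding_val_GL3.comp IsEmbedding.subtypeVal
  isClosed_range := by
    rw [range_mat]
    exact isClosed_setOf_preserves

/-- `U21` is closed in `GL₃(ℂ)`. [cite: Jacobowitz1990, Ch. 2 §1 (p. 40)] -/
theorem isClosed_U21 : IsClosed (U21 : Set GL3) := by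
  have h : (U21 : Set GL3) =
      (Units.val : GL3 → Matrix (Fin 3) (Fin 3) ℂ) ⁻¹' {g | gᴴ * J * g = J} := by
    ext g
    rfl
  rw [h]
  exact isClosed_setOf_preserves.preimage Units.continuous_val

/-! ## §2 Instances -/

/-- `M₃(ℂ) ≅ ℂ⁹` is locally compact (the matrix topology is the product topology). [folklore] -/
instance instLocallyCompactSpaceMatrix3 : LocallyCompactSpace (Matrix (Fin 3) (Fin 3) ℂ) :=
  inferInstanceAs (LocallyCompactSpace (Fin 3 → Fin 3 → ℂ))

/-- `M₃(ℂ)` is second countable. [folklore] -/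
instance instSecondCountableTopologyMatrix3 : SecondCountableTopology (Matrix (Fin 3) (Fin 3) ℂ) :=
  inferInstanceAs (SecondCountableTopology (Fin 3 → Fin 3 → ℂ))

/-- `U(2,1)` is locally compact (closed embedding into `M₃(ℂ) ≅ ℂ⁹`). [cite: Folland1995, §2.2] -/
instance instLocallyCompactSpaceU21 : LocallyCompactSpace U21 :=
  isClosedEmbedding_mat.locallyCompactSpace

/-- `U(2,1)` is second countable (embedding into `M₃(ℂ)`). [folklore] -/
instance instSecondCountableTopologyU21 : SecondCountableTopology U21 :=
  isClosedEmbedding_mat.isEmbedding.secondCountableTopology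

/-- `U(2,1)` is σ-compact. [folklore] -/
instance instSigmaCompactSpaceU21 : SigmaCompactSpace U21 :=
  sigmaCompactSpace_of_locallyCompact_secondCountable

/-- The Borel σ-algebra on `U(2,1)` (the tree's canonical measurable structure on `U21`; every
measure-theoretic statement about `U(2,1)` in the tree is over THIS instance). [folklore] -/
noncomputable instance instMeasurableSpaceU21 : MeasurableSpace U21 := borel U21

/-- The measurable structure on `U(2,1)` IS the Borel σ-algebra. [folklore] -/
instance instBorelSpaceU21 : BorelSpace U21 := ⟨rfl⟩

/-- Multiplication on `U(2,1)` is jointly measurable (second countable topological group).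
[folklore] -/
instance instMeasurableMul₂U21 : MeasurableMul₂ U21 := inferInstance

/-- Inversion on `U(2,1)` is measurable. [folklore] -/
instance instMeasurableInvU21 : MeasurableInv U21 := inferInstance

/-! ## §3 Haar measure -/

/-- `U(2,1)` carries a Haar measure. [cite: Folland1995, §2.2 Thm. 2.10] -/
theorem exists_isHaarMeasure_U21 : ∃ μ : Measure U21, μ.IsHaarMeasure :=
  ⟨Measure.haar, inferInstance⟩

/-- Any two Haar measures on `U(2,1)` are proportional (second-countable locally compact group).
[cite: Folland1995, §2.2 Thm. 2.20] -/
theorem isHaarMeasure_eq_smul_U21 (μ ν : Measure U21) [μ.IsHaarMeasure] [ν.IsHaarMeasure] :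
    ∃ c : ENNReal, c ≠ 0 ∧ c ≠ ⊤ ∧ μ = c • ν := by
  refine ⟨μ.haarScalarFactor ν, ?_, ENNReal.coe_ne_top, ?_⟩
  · exact_mod_cast (Measure.haarScalarFactor_pos_of_isHaarMeasure μ ν).ne'
  · exact Measure.isMulLeftInvariant_eq_smul_of_regular μ ν

end BallModel

end Literature.Geometry.ComplexHyperbolic
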